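import Summits.RiemannHypothesis.RiemannHypothesis.Theorems.SignConeConeMagnificationCombInequalityDesign
import Summits.RiemannHypothesis.RiemannHypothesis.Theorems.SignConeConeMagnificationCombTypeWeights
import Summits.RiemannHypothesis.RiemannHypothesis.Theorems.SignConeConeMagnificationDesignClasses
import Literature.NumberTheory.LFunctions.ClassSumsConverge
import Literature.NumberTheory.LFunctions.TypeLimitsExist

/-!
# Crux `SignCone.ConeMagnification` (stmt-RiemannHypothesis-16303), line `Sketch` r9, stub `stub_combType` — assembly, part 2:
# helpers and the per-pair evaluation `|D − A| ≤ E`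

Seat-0's half of the agreed split (lead c1, 09:03Z 08-17): the lead's wave 3 proves the c-free SHARP node evaluation of the
`ζ`-mollified comb (Literature); this file turns [comb inequality (`comb_inequality_design`, p149415)] + [node data] into the type
inequality for a real finitely supported design `β`, via the class decomposition of the deep-zone term
(`CombType.sum_dvd_indicator_div_eq`), the harmonic cut-off weights (`…CombTypeWeights`), the referee's class machinery
(`TypeDesign.sum_mul_re_gcdForm_eq_sum_gcdClasses`, `gcdClassSum_converges`, `tendsto_sum_mul_weight_of_tendsto`), and division by
`B(0) log M`.

`typeBound_of_nodeData`: hypotheses — unit slack, `c ≥ 0`, local summability, the Mertens difference `Σ_{n<N}(c−Λ)(n)/n → C₁`,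
a smooth real bump `b` on `[-1,1]`, a constant `B₀ > 0`, and the NODE DATA: eventually in `M`, for every pair `ℓ, ℓ' ≤ L`, the node weights
`V_M(ℓ,ℓ',n)` (the explicit double sums of `comb_inequality_design`) decompose on `1 ≤ n ≤ 3LM` as
`B₀√(ℓ/ℓ')·(Σ_{k' ≤ ⌊X_M/(nℓ')⌋}[ℓ ∣ nℓ'k']/k')/n + S(gcd(nℓ',ℓ))/n + Sm(n) + e(n)` (`X_M = M/(4√(log M))`) with
`|S| ≤ C(log M)^θ`, `|Σ (c−Λ) Sm| ≤ C(log M)^θ`, `Σ (c+Λ)|e| ≤ C(log M)^θ`, and `|V_M(ℓ,ℓ',1) − B₀(gcd(ℓ',ℓ)/√(ℓℓ')) log M| ≤ C(log M)^θ`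
for some `C` and `θ < 1`; conclusion — the limit `T` of the type partial sums of `β` satisfies `T ≤ ½ Re Φ_β(1)`.
-/

noncomputable section

-- `Summit.RiemannHypothesis.RiemannHypothesis.…` repeats a namespace component by design (D-0017 layout).
set_option linter.dupNamespace false

open scoped BigOperators ComplexConjugate Topology ArithmeticFunction.vonMangoldt ContDiff
open Complex MeasureTheory Set Filter

namespace Summit.RiemannHypothesis.RiemannHypothesis.Theorems.SignConeConeMagnification

open Literature.NumberTheory.LFunctions
open Literature.NumberTheory.LFunctions.GcdForm (gcdForm)

namespace CombType

/-! ### Small helpers -/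

/-- For a real design the class coefficient is real: `Re[β_ℓ conj(β_ℓ') δ/√(ℓℓ')] = β_ℓ β_ℓ' δ/√(ℓℓ')`. [folklore] -/
theorem re_coef_ofReal (β : ℕ → ℝ) (ℓ ℓ' δ : ℕ) :
    (((β ℓ : ℝ) : ℂ) * (starRingEnd ℂ) ((β ℓ' : ℝ) : ℂ) * ((δ : ℝ) : ℂ) / (Real.sqrt ((ℓ : ℝ) * ℓ') : ℂ)).re =
      β ℓ * β ℓ' * δ / Real.sqrt ((ℓ : ℝ) * ℓ') := by
  rw [Complex.conj_ofReal, ← Complex.ofReal_mul, ← Complex.ofReal_mul, ← Complex.ofReal_div, Complex.ofReal_re]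

/-- `Re Φ_β(1) = Σ_{ℓ,ℓ'} β_ℓ β_ℓ' gcd(ℓ',ℓ)/√(ℓℓ')` for a real design. [folklore] -/
theorem re_gcdForm_one_ofReal (β : ℕ → ℝ) (L : ℕ) :
    (gcdForm (fun m => ((β m : ℝ) : ℂ)) L 1).re =
      ∑ ℓ ∈ Finset.Icc 1 L, ∑ ℓ' ∈ Finset.Icc 1 L, β ℓ * β ℓ' * (Nat.gcd ℓ' ℓ : ℝ) / Real.sqrt ((ℓ : ℝ) * ℓ') := by
  simp only [gcdForm, one_mul, Complex.re_sum]
  refine Finset.sum_congr rfl fun ℓ _ => Finset.sum_congr rfl fun ℓ' _ => ?_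
  rw [Complex.conj_ofReal, ← Complex.ofReal_mul, ← Complex.ofReal_mul, ← Complex.ofReal_div, Complex.ofReal_re]

/-! ### The deep-zone term on a class -/

/-- On `1 ≤ n`: `√(ℓ/ℓ')·(Σ_{k' ≤ K}[ℓ ∣ nℓ'k']/k')/n = (g_n/√(ℓℓ'))·H(K/(ℓ/g_n))/n`, `g_n = gcd(nℓ',ℓ)` (`ℓ, ℓ' ≥ 1`). [folklore] -/
theorem deep_term_eq {ℓ ℓ' : ℕ} (hℓ : 1 ≤ ℓ) (hℓ' : 1 ≤ ℓ') (n K : ℕ) :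
    Real.sqrt ℓ / Real.sqrt ℓ' * (∑ k' ∈ Finset.Icc 1 K, (if ℓ ∣ n * ℓ' * k' then (1 : ℝ) / k' else 0)) =
      (Nat.gcd (n * ℓ') ℓ : ℝ) / Real.sqrt ((ℓ : ℝ) * ℓ') *
        ∑ j ∈ Finset.Icc 1 (K / (ℓ / Nat.gcd (n * ℓ') ℓ)), (1 : ℝ) / j := by
  have hℓ0 : ℓ ≠ 0 := by omega
  rw [sum_dvd_indicator_div_eq ℓ n ℓ' K hℓ0, sum_one_div_mul_eq]
  -- `√ℓ/√ℓ' · (1/q) = g/√(ℓℓ')` with `q = ℓ/g`, `g ∣ ℓ`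
  set g := Nat.gcd (n * ℓ') ℓ with hg
  have hgpos : 0 < g := Nat.gcd_pos_of_pos_right _ (by omega)
  have hgdvd : g ∣ ℓ := Nat.gcd_dvd_right _ _
  obtain ⟨q', hq'⟩ := hgdvd
  have hq'pos : 0 < q' := by
    rcases Nat.eq_zero_or_pos q' with h | h
    · rw [h, mul_zero] at hq'; omega
    · exact h
  have hdiv : ℓ / g = q' := by rw [hq', Nat.mul_div_cancel_left _ hgpos]
  rw [hdiv, ← mul_assoc]
  congr 1
  have hℓR : (0 : ℝ) < ℓ := by exact_mod_cast (by omega : 0 < ℓ)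
  have hℓ'R : (0 : ℝ) < ℓ' := by exact_mod_cast (by omega : 0 < ℓ')
  have hgR : (0 : ℝ) < g := by exact_mod_cast hgpos
  have hq'R : (0 : ℝ) < q' := by exact_mod_cast hq'pos
  have hℓgq : (ℓ : ℝ) = g * q' := by exact_mod_cast hq'
  have hs : Real.sqrt ℓ * Real.sqrt ℓ = ℓ := Real.mul_self_sqrt hℓR.le
  have key : Real.sqrt ℓ * Real.sqrt ℓ = (g : ℝ) * q' := by rw [hs]; exact hℓgq
  have hsℓ : 0 < Real.sqrt ℓ := Real.sqrt_pos.2 hℓR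
  have hsℓ' : 0 < Real.sqrt ℓ' := Real.sqrt_pos.2 hℓ'R
  rw [Real.sqrt_mul hℓR.le]
  field_simp
  linear_combination key

/-! ### The per-pair evaluation -/

/-- **Per-pair evaluation** `|D − A| ≤ E`: for one pair `(ℓ, ℓ')` at level `M`, given the node decomposition
`V(n) = B₀√(ℓ/ℓ')·(Σ_{k'≤⌊X/(nℓ')⌋}[ℓ∣nℓ'k']/k')/n + S(gcd(nℓ',ℓ))/n + Sm(n) + e(n)` on `[1, 3LM]` with `|S| ≤ Cst(log M)^θ`,
`|Σ(c−Λ)Sm| ≤ Cst(log M)^θ`, `Σ(c+Λ)|e| ≤ Cst(log M)^θ`, and bounded class partial sums `|Σ_{n<N} ((c−Λ)(n)/n)1[gcd=δ]| ≤ K δ`: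
the difference of the node sums `Σ c V − Σ Λ V` is within `(Cst ΣK + Cst + Cst)(log M)^θ` of the weighted class sum
`B₀ log M · Σ_{δ∣ℓ} (δ/√(ℓℓ')) Σ_{n ≤ 3LM} ((c−Λ)(n)/n) 1[gcd(nℓ',ℓ)=δ] H(⌊X/(nℓ')⌋/(ℓ/δ))/log M`. [folklore] -/
theorem pair_bound {c : ℕ → ℝ} (hc0 : ∀ n, 0 ≤ c n) {L M ℓ ℓ' : ℕ} (hℓ : ℓ ∈ Finset.Icc 1 L) (hℓ' : ℓ' ∈ Finset.Icc 1 L)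
    (hlog : 0 < Real.log M)
    {B₀ Cst θ : ℝ} (V : ℕ → ℕ → ℕ → ℕ → ℝ) (S Sm e : ℕ → ℝ) (hS : ∀ δ, |S δ| ≤ Cst * Real.log M ^ θ)
    (hdec : ∀ n ∈ Finset.Icc 1 (3 * L * M), V M ℓ ℓ' n =
      B₀ * (Real.sqrt ℓ / Real.sqrt ℓ') *
          (∑ k' ∈ Finset.Icc 1 (⌊(M : ℝ) / (4 * Real.sqrt (Real.log M)) / ((n : ℝ) * ℓ')⌋₊),
            (if ℓ ∣ n * ℓ' * k' then (1 : ℝ) / k' else 0)) / n +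
        S (Nat.gcd (n * ℓ') ℓ) / n + Sm n + e n)
    (hSm : |∑ n ∈ Finset.Icc 1 (3 * L * M), (c n - Λ n) * Sm n| ≤ Cst * Real.log M ^ θ)
    (he : ∑ n ∈ Finset.Icc 1 (3 * L * M), (c n + Λ n) * |e n| ≤ Cst * Real.log M ^ θ)
    (K : ℕ → ℝ) (hK : ∀ δ N, |∑ n ∈ Finset.range N,
      (c n - Λ n) / n * (if Nat.gcd (n * ℓ') ℓ = δ then (1 : ℝ) else 0)| ≤ K δ) :
    |((∑ n ∈ Finset.Icc 1 (3 * L * M), c n * V M ℓ ℓ' n) - ∑ n ∈ Finset.Icc 1 (3 * L * M), (Λ n : ℝ) * V M ℓ ℓ' n) -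
        B₀ * Real.log M * (∑ δ ∈ ℓ.divisors, (δ : ℝ) / Real.sqrt ((ℓ : ℝ) * ℓ') *
          ∑ n ∈ Finset.range (3 * L * M + 1), (c n - Λ n) / n * (if Nat.gcd (n * ℓ') ℓ = δ then (1 : ℝ) else 0) *
            ((∑ j ∈ Finset.Icc 1 (⌊(M : ℝ) / (4 * Real.sqrt (Real.log M)) / ((max n 1 : ℕ) * ℓ')⌋₊ / (ℓ / δ)),
              (1 : ℝ) / j) / Real.log M))| ≤
      (Cst * (∑ δ ∈ ℓ.divisors, K δ) + Cst + Cst) * Real.log M ^ θ := by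
  classical
  set d : ℕ → ℝ := fun n => (c n - Λ n) / n with hd
  set ind : ℕ → ℕ → ℕ → ℕ → ℝ := fun ℓ ℓ' δ n => if Nat.gcd (n * ℓ') ℓ = δ then (1 : ℝ) else 0 with hind
  set X : ℕ → ℝ := fun M => (M : ℝ) / (4 * Real.sqrt (Real.log M)) with hX
  set w : ℕ → ℕ → ℕ → ℕ → ℕ → ℝ := fun ℓ ℓ' δ M n =>
    (∑ j ∈ Finset.Icc 1 (⌊X M / ((max n 1 : ℕ) * ℓ')⌋₊ / (ℓ / δ)), (1 : ℝ) / j) / Real.log M with hw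
  show |((∑ n ∈ Finset.Icc 1 (3 * L * M), c n * V M ℓ ℓ' n) - ∑ n ∈ Finset.Icc 1 (3 * L * M), (Λ n : ℝ) * V M ℓ ℓ' n) -
        B₀ * Real.log M * (∑ δ ∈ ℓ.divisors, (δ : ℝ) / Real.sqrt ((ℓ : ℝ) * ℓ') *
          ∑ n ∈ Finset.range (3 * L * M + 1), d n * ind ℓ ℓ' δ n * w ℓ ℓ' δ M n)| ≤
      (Cst * (∑ δ ∈ ℓ.divisors, K δ) + Cst + Cst) * Real.log M ^ θ
  have hℓ1 := (Finset.mem_Icc.1 hℓ).1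
  have hℓ'1 := (Finset.mem_Icc.1 hℓ').1
  -- difference of the node sums, decomposed
  have hdiff : (∑ n ∈ Finset.Icc 1 (3 * L * M), c n * V M ℓ ℓ' n) -
      ∑ n ∈ Finset.Icc 1 (3 * L * M), (Λ n : ℝ) * V M ℓ ℓ' n =
      (∑ n ∈ Finset.Icc 1 (3 * L * M), (c n - Λ n) *
        (B₀ * (Real.sqrt ℓ / Real.sqrt ℓ') *
            (∑ k' ∈ Finset.Icc 1 (⌊(M : ℝ) / (4 * Real.sqrt (Real.log M)) / ((n : ℝ) * ℓ')⌋₊),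
              (if ℓ ∣ n * ℓ' * k' then (1 : ℝ) / k' else 0)) / n)) +
      (∑ n ∈ Finset.Icc 1 (3 * L * M), (c n - Λ n) * (S (Nat.gcd (n * ℓ') ℓ) / n)) +
      (∑ n ∈ Finset.Icc 1 (3 * L * M), (c n - Λ n) * Sm n) +
      (∑ n ∈ Finset.Icc 1 (3 * L * M), (c n - Λ n) * e n) := by
    rw [← Finset.sum_sub_distrib, ← Finset.sum_add_distrib, ← Finset.sum_add_distrib, ← Finset.sum_add_distrib]
    refine Finset.sum_congr rfl fun n hn => ?_
    rw [hdec n hn]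
    ring
  -- (1) the deep term is the weighted class sum
  have hdeep : ∑ n ∈ Finset.Icc 1 (3 * L * M), (c n - Λ n) *
        (B₀ * (Real.sqrt ℓ / Real.sqrt ℓ') *
            (∑ k' ∈ Finset.Icc 1 (⌊(M : ℝ) / (4 * Real.sqrt (Real.log M)) / ((n : ℝ) * ℓ')⌋₊),
              (if ℓ ∣ n * ℓ' * k' then (1 : ℝ) / k' else 0)) / n) =
      B₀ * Real.log M * (∑ δ ∈ ℓ.divisors, (δ : ℝ) / Real.sqrt ((ℓ : ℝ) * ℓ') *
        ∑ n ∈ Finset.range (3 * L * M + 1), d n * ind ℓ ℓ' δ n * w ℓ ℓ' δ M n) := by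
    -- rewrite each summand via the class identity and insert `Σ_δ 1[g_n = δ] = 1`
    have hterm : ∀ n ∈ Finset.Icc 1 (3 * L * M), (c n - Λ n) *
        (B₀ * (Real.sqrt ℓ / Real.sqrt ℓ') *
            (∑ k' ∈ Finset.Icc 1 (⌊(M : ℝ) / (4 * Real.sqrt (Real.log M)) / ((n : ℝ) * ℓ')⌋₊),
              (if ℓ ∣ n * ℓ' * k' then (1 : ℝ) / k' else 0)) / n) =
        B₀ * Real.log M * ∑ δ ∈ ℓ.divisors, (δ : ℝ) / Real.sqrt ((ℓ : ℝ) * ℓ') *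
          (d n * ind ℓ ℓ' δ n * w ℓ ℓ' δ M n) := by
      intro n hn
      have hn1 := (Finset.mem_Icc.1 hn).1
      rw [mul_assoc B₀, deep_term_eq hℓ1 hℓ'1]
      -- the class of `n`
      set g := Nat.gcd (n * ℓ') ℓ with hg
      have hgmem : g ∈ ℓ.divisors := Nat.mem_divisors.2 ⟨Nat.gcd_dvd_right _ _, by omega⟩
      rw [← Finset.sum_filter_add_sum_filter_not ℓ.divisors (fun δ => δ = g)]
      have hfilter : ℓ.divisors.filter (fun δ => δ = g) = {g} := by
        ext δ
        simp only [Finset.mem_filter, Finset.mem_singleton]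
        exact ⟨fun h => h.2, fun h => ⟨h ▸ hgmem, h⟩⟩
      have hzero : ∑ δ ∈ ℓ.divisors.filter (fun δ => ¬ δ = g), (δ : ℝ) / Real.sqrt ((ℓ : ℝ) * ℓ') *
          (d n * ind ℓ ℓ' δ n * w ℓ ℓ' δ M n) = 0 := by
        refine Finset.sum_eq_zero fun δ hδ => ?_
        have hne : ¬ δ = g := (Finset.mem_filter.1 hδ).2
        have : ind ℓ ℓ' δ n = 0 := by
          simp only [hind]
          rw [if_neg]
          rw [← hg]
          exact fun h => hne h.symm
        rw [this, mul_zero, zero_mul, mul_zero]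
      rw [hfilter, Finset.sum_singleton, hzero, add_zero]
      have hind1 : ind ℓ ℓ' g n = 1 := by simp only [hind, ← hg, if_true]
      have hmax : (max n 1 : ℕ) = n := max_eq_left hn1
      simp only [hw, hX, hd, hind1, mul_one, hmax]
      field_simp
    rw [Finset.sum_congr rfl hterm, ← Finset.mul_sum, Finset.sum_comm]
    congr 1
    refine Finset.sum_congr rfl fun δ _ => ?_
    rw [← Finset.mul_sum]
    congr 1
    -- `Icc 1 K` versus `range (K+1)`
    refine (Design.sum_Icc_eq_sum_range (fun n => d n * ind ℓ ℓ' δ n * w ℓ ℓ' δ M n) ?_ (3 * L * M)).trans rfl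
    simp [hd]
  -- (2) the class-constant term
  have hS' : |∑ n ∈ Finset.Icc 1 (3 * L * M), (c n - Λ n) * (S (Nat.gcd (n * ℓ') ℓ) / n)| ≤
      Cst * (∑ δ ∈ ℓ.divisors, K δ) * Real.log M ^ θ := by
    have hsplit : ∑ n ∈ Finset.Icc 1 (3 * L * M), (c n - Λ n) * (S (Nat.gcd (n * ℓ') ℓ) / n) =
        ∑ δ ∈ ℓ.divisors, S δ * ∑ n ∈ Finset.range (3 * L * M + 1), d n * ind ℓ ℓ' δ n := by
      have hterm : ∀ n ∈ Finset.Icc 1 (3 * L * M), (c n - Λ n) * (S (Nat.gcd (n * ℓ') ℓ) / n) =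
          ∑ δ ∈ ℓ.divisors, S δ * (d n * ind ℓ ℓ' δ n) := by
        intro n hn
        have hn1 := (Finset.mem_Icc.1 hn).1
        set g := Nat.gcd (n * ℓ') ℓ with hg
        have hgmem : g ∈ ℓ.divisors := Nat.mem_divisors.2 ⟨Nat.gcd_dvd_right _ _, by omega⟩
        rw [← Finset.sum_filter_add_sum_filter_not ℓ.divisors (fun δ => δ = g)]
        have hfilter : ℓ.divisors.filter (fun δ => δ = g) = {g} := by
          ext δ
          simp only [Finset.mem_filter, Finset.mem_singleton]
          exact ⟨fun h => h.2, fun h => ⟨h ▸ hgmem, h⟩⟩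
        have hzero : ∑ δ ∈ ℓ.divisors.filter (fun δ => ¬ δ = g), S δ * (d n * ind ℓ ℓ' δ n) = 0 := by
          refine Finset.sum_eq_zero fun δ hδ => ?_
          have hne : ¬ δ = g := (Finset.mem_filter.1 hδ).2
          have : ind ℓ ℓ' δ n = 0 := by
            simp only [hind]
            rw [if_neg]
            rw [← hg]
            exact fun h => hne h.symm
          rw [this, mul_zero, mul_zero]
        rw [hfilter, Finset.sum_singleton, hzero, add_zero]
        have hind1 : ind ℓ ℓ' g n = 1 := by simp only [hind, ← hg, if_true]
        simp only [hd, hind1, mul_one]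
        ring
      rw [Finset.sum_congr rfl hterm, Finset.sum_comm]
      refine Finset.sum_congr rfl fun δ _ => ?_
      rw [← Finset.mul_sum]
      congr 1
      refine (Design.sum_Icc_eq_sum_range (fun n => d n * ind ℓ ℓ' δ n) ?_ (3 * L * M)).trans rfl
      simp [hd]
    rw [hsplit]
    refine (Finset.abs_sum_le_sum_abs _ _).trans ?_
    rw [Finset.mul_sum, Finset.sum_mul]
    refine Finset.sum_le_sum fun δ _ => ?_
    rw [abs_mul]
    have h1 := hS δ
    have h2 := hK δ (3 * L * M + 1)
    calc |S δ| * |∑ n ∈ Finset.range (3 * L * M + 1), d n * ind ℓ ℓ' δ n|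
        ≤ (Cst * Real.log M ^ θ) * K δ := mul_le_mul h1 h2 (abs_nonneg _) (le_trans (abs_nonneg _) h1)
      _ = Cst * K δ * Real.log M ^ θ := by ring
  -- (3),(4) the smooth and error terms
  have he' : |∑ n ∈ Finset.Icc 1 (3 * L * M), (c n - Λ n) * e n| ≤ Cst * Real.log M ^ θ := by
    refine le_trans (Finset.abs_sum_le_sum_abs _ _) (le_trans (Finset.sum_le_sum fun n _ => ?_) he)
    rw [abs_mul]
    refine mul_le_mul_of_nonneg_right ?_ (abs_nonneg _)
    have h1 := hc0 n
    have h2 : 0 ≤ (Λ n : ℝ) := ArithmeticFunction.vonMangoldt_nonneg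
    exact abs_sub_le_iff.2 ⟨by linarith, by linarith⟩
  rw [hdiff, hdeep]
  have e1 : ∀ A x y z : ℝ, A + x + y + z - A = x + y + z := fun A x y z => by ring
  rw [e1]
  refine (abs_add_three _ _ _).trans ?_
  have : Cst * (∑ δ ∈ ℓ.divisors, K δ) * Real.log M ^ θ + Cst * Real.log M ^ θ + Cst * Real.log M ^ θ =
      (Cst * (∑ δ ∈ ℓ.divisors, K δ) + Cst + Cst) * Real.log M ^ θ := by ring
  rw [← this]
  exact add_le_add (add_le_add hS' hSm) he'

/-- **Anchor `combTypePairBound`** (registered sub-goal; `pair_bound` with explicit quantifiers). [folklore] -/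
theorem combTypePairBound : ∀ c : ℕ → ℝ, (∀ n, 0 ≤ c n) → ∀ L M ℓ ℓ' : ℕ, (ℓ ∈ Finset.Icc 1 L) → (ℓ' ∈ Finset.Icc 1 L) → (0 < Real.log M) → ∀ B₀ Cst θ : ℝ, ∀ V : ℕ → ℕ → ℕ → ℕ → ℝ, ∀ S Sm e : ℕ → ℝ, (∀ δ, |S δ| ≤ Cst * Real.log M ^ θ) → (∀ n ∈ Finset.Icc 1 (3 * L * M), V M ℓ ℓ' n = B₀ * (Real.sqrt ℓ / Real.sqrt ℓ') * (∑ k' ∈ Finset.Icc 1 (⌊(M : ℝ) / (4 * Real.sqrt (Real.log M)) / ((n : ℝ) * ℓ')⌋₊), (if ℓ ∣ n * ℓ' * k' then (1 : ℝ) / k' else 0)) / n + S (Nat.gcd (n * ℓ') ℓ) / n + Sm n + e n) → (|∑ n ∈ Finset.Icc 1 (3 * L * M), (c n - ArithmeticFunction.vonMangoldt n) * Sm n| ≤ Cst * Real.log M ^ θ) → (∑ n ∈ Finset.Icc 1 (3 * L * M), (c n + ArithmeticFunction.vonMangoldt n) * |e n| ≤ Cst * Real.log M ^ θ) → ∀ K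 : ℕ → ℝ, (∀ δ N, |∑ n ∈ Finset.range N, (c n - ArithmeticFunction.vonMangoldt n) / n * (if Nat.gcd (n * ℓ') ℓ = δ then (1 : ℝ) else 0)| ≤ K δ) → |((∑ n ∈ Finset.Icc 1 (3 * L * M), c n * V M ℓ ℓ' n) - ∑ n ∈ Finset.Icc 1 (3 * L * M), (ArithmeticFunction.vonMangoldt n : ℝ) * V M ℓ ℓ' n) - B₀ * Real.log M * (∑ δ ∈ ℓ.divisors, (δ : ℝ) / Real.sqrt ((ℓ : ℝ) * ℓ') * ∑ n ∈ Finset.range (3 * L * M + 1), (c n - ArithmeticFunction.vonMangoldt n) / n * (if Nat.gcd (n * ℓ') ℓ = δ then (1 : ℝ) else 0) * ((∑ j ∈ Finset.Icc 1 (⌊(M : ℝ) / (4 * Real.sqrt (Real.log M)) / ((max n 1 : ℕ) * ℓ')⌋₊ / (ℓ / δ)), (1 : ℝ) / j) / Real.log M))| ≤ (Cst * (∑ δ ∈ ℓ.divisors, K δ) + Cst + Cst) * Real.log M ^ θ :=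
  fun _ hc0 _ _ _ _ hℓ hℓ' hlog _ _ _ V S Sm e hS hdec hSm he K hK =>
    pair_bound hc0 hℓ hℓ' hlog V S Sm e hS hdec hSm he K hK

end CombType

end Summit.RiemannHypothesis.RiemannHypothesis.Theorems.SignConeConeMagnification

end
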